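import Summits.Ventures.CertifiedQuantumChemistry.Rows.StrongCouplingBookkeeping
import Summits.Ventures.CertifiedQuantumChemistry.Rows.ClaimNAnalyticStep
import Literature.NumberTheory.LFunctions.MauduitRivatTypeIPrelims
import Mathlib.Analysis.Complex.Norm
import HarnessLib

/-!
# Ventures/CertifiedQuantumChemistry — Rows/StrongCouplingDoublonBound.lean: CLAIM N step (1) ON THE
# CELL'S PROGRAMME — an energy `≤ E_core` forces total doublon weight `≤ C²/U²` on every feasible
# pair of the two-positivity programme of a half-filled Hubbard-type model

HONEST FRAMING (verbatim): certified bounds for a stated model Hamiltonian in a stated basis; not a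
claim about the real molecule beyond that model. Nothing here is a state, a row, a claim node or a
value of record; the statements are about ARBITRARY feasible pairs of the abstract `D, Q, G`
programme with sector rows (`IsDQGFeasibleSector`) of a Hubbard-type integral table, the cell's
test-vector models `hubbardRingTV L t U` included (sibling `Rows/HubbardRingTVDoublonBound.lean`).

Seat rdm-B (gen 35), zero compute; theorems only (no `def`). Companion of
`Rows/StrongCouplingBookkeeping.lean` (gen 21: the hop bound `‖γ_{iσ,jσ}‖ ≤ √d_i + √e_i` and
`Σ e = Σ d` at half filling) and of `Rows/ClaimNAnalyticStep.lean` (gen 35: the analytic skeleton of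
CLAIM N, whose §1 is the scalar step `U·s ≤ C·√s ⇒ s ≤ (C/U)²`). CLAIM N (HOME/INBOX L765 (ii);
`STRUCTURE.md` §2.2.13 (ii)) opens with the A-PRIORI BOUND, stated in words: "the typed hop bound
… and `Σ_i e_i = Σ_i d_i` (half filling) give `OPT ≥ −C√(Σd) + U·Σd`, so `0 ≥ OPT` forces
`Σ_i d_i ≤ C²ε²`, i.e. EVERY scaled variable is bounded along the sequence". This file TYPES that
sentence for the cell's actual relaxation and integral tables:

* §1 bookkeeping on a feasible pair (`IsDQGFeasible`): `two_apply_samePair_eq_zero` (a same-spin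
  same-site pair entry of `Γ` vanishes, antisymmetry), `two_apply_swap_sameSite` /
  `qMap_apply_swap_sameSite` (the `(↓↑)` doublon / holon weight of a site equals its `(↑↓)` one),
  `sum_norm_hop_le` (`‖γ_{p↑,q↑}‖ + ‖γ_{p↓,q↓}‖ ≤ 2(√d_p + √e_p)` for `p ≠ q`, the hop bound of the
  bookkeeping file summed over spin); Cauchy–Schwarz for square roots `Σ_p √x_p ≤ √(|Λ|·Σ_p x_p)`
  is the tree's `Literature.NumberTheory.LFunctions.MauduitRivat.sum_sqrt_le_sqrt_card_mul`
  (imported and reused, not restated).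
* §2 THE ENERGY OF A HUBBARD-TYPE TABLE on an abstract pair: one-body integrals `h` with ZERO
  DIAGONAL and `‖h_pq‖ ≤ τ`, two-body integrals ON-SITE ONLY, `(pq|rs) = U·[p = q = r = s]`
  (`U ∈ ℝ`), scalar `E_core`: `interaction_eq` — the interaction term of `rdmEnergy` is EXACTLY
  `U · Σ_p d_p` (`d_p = Γ_{(p↑,p↓),(p↑,p↓)}`); `re_oneBody_ge` — the one-body term is
  `≥ −4 τ |Λ| √|Λ| · √(Σ_p Re d_p)` at half filling; **`re_rdmEnergy_ge`** — hence
  `Re E(γ, Γ) ≥ Re E_core + U·s − 4τ|Λ|^{3/2}·√s` with `s = Σ_p Re d_p ≥ 0` for EVERY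
  `IsDQGFeasibleSector a b γ Γ` with `a + b = |Λ| ≥ 2`; **`sum_doublon_le_sq`** — so
  `Re E(γ, Γ) ≤ Re E_core` and `U > 0` force `s ≤ (4τ|Λ|^{3/2}/U)²` (the scalar step of the ClaimN
  file): the total doublon weight — and with it (`Σ e = Σ d`, the hop bound, the `2 × 2` minors)
  every scaled variable of the words — is `O(1/U²)` along any such family, uniformly in the pair.
  (The constant is deliberately crude — every ordered pair `(p, q)` is charged, not only bonds —
  since CLAIM N needs SOME `C(L, t)`, not the best one.)
* The cell's files (`hubbardRingTV L t U`: `h_pp = 0`, `‖h_pq‖ ≤ |t|`, on-site `U`, `E_core = 0`) are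
  instantiated in the sibling `Rows/HubbardRingTVDoublonBound.lean`.

Everything is PROVED (0 sorry), standard axioms; no definitions, no named facts; no claim node,
hint, row or CERTIFIED cell depends on it. References (docstring-only): D. A. Mazziotti, Adv. Chem.
Phys. 134 (2007) ch. 3 §II (the `D, Q, G` programme and its energy functional — the tree's
`Literature/MathematicalPhysics/QuantumChemistry/VariationalRDMRelaxation.lean`); B. Verstichel
et al., Phys. Rev. Lett. 108 (2012) 213001 (doublon weights of the PQG optimum at large `U`); the
rest is elementary (Cauchy–Schwarz, `|Re z| ≤ ‖z‖`).
-/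

noncomputable section

namespace Summit.Ventures.CertifiedQuantumChemistry

open Matrix Finset
open Literature.MathematicalPhysics.QuantumLattice Literature.MathematicalPhysics.QuantumChemistry
open scoped ComplexOrder

namespace StrongCouplingDoublon

variable {Λ : Type*} [LinearOrder Λ] [Fintype Λ]

/-! ### §1 Bookkeeping on a feasible pair -/

section Pair

variable {γ : Matrix (Orb Λ) (Orb Λ) ℂ} {Γ : Matrix (Orb Λ × Orb Λ) (Orb Λ × Orb Λ) ℂ} {N : ℕ}

omit [LinearOrder Λ] [Fintype Λ] in
/-- A same-spin same-site pair entry of an antisymmetric `Γ` vanishes: `Γ_{(x,x),q} = 0`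
(`Γ_{(j,i),q} = −Γ_{(i,j),q}` at `i = j`). [folklore] -/
theorem two_apply_samePair_eq_zero (hanti : ∀ i j q, Γ (j, i) q = -Γ (i, j) q) (x : Orb Λ)
    (q : Orb Λ × Orb Λ) : Γ (x, x) q = 0 := by
  have h := hanti x x q
  linear_combination h / 2

omit [LinearOrder Λ] [Fintype Λ] in
/-- The `(τσ)` same-site diagonal entry of `Γ` equals the `(στ)` one:
`Γ_{(pτ,pσ),(pτ,pσ)} = Γ_{(pσ,pτ),(pσ,pτ)}` (two antisymmetry signs cancel) — the `(↓↑)` doublon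
weight of a site is its `(↑↓)` doublon weight. [folklore] -/
theorem two_apply_swap_sameSite (hfst : ∀ i j q, Γ (j, i) q = -Γ (i, j) q)
    (hsnd : ∀ p k l, Γ p (l, k) = -Γ p (k, l)) (p : Λ) (σ τ : Fin 2) :
    Γ (orb p τ, orb p σ) (orb p τ, orb p σ) = Γ (orb p σ, orb p τ) (orb p σ, orb p τ) := by
  rw [hfst (orb p σ) (orb p τ), hsnd (orb p σ, orb p τ) (orb p σ) (orb p τ), neg_neg]

omit [Fintype Λ] in
/-- The `(τσ)` holon weight of a site equals its `(στ)` holon weight: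
`²Q_{(pτ,pσ),(pτ,pσ)} = ²Q_{(pσ,pτ),(pσ,pτ)}` (`σ ≠ τ`; both equal
`1 − γ_{pσ,pσ} − γ_{pτ,pτ} + d_p`, `qMap_apply_sameSite`). [folklore] -/
theorem qMap_apply_swap_sameSite (hfst : ∀ i j q, Γ (j, i) q = -Γ (i, j) q)
    (hsnd : ∀ p k l, Γ p (l, k) = -Γ p (k, l)) (p : Λ) {σ τ : Fin 2} (hστ : σ ≠ τ) :
    qMap γ Γ (orb p τ, orb p σ) (orb p τ, orb p σ) = qMap γ Γ (orb p σ, orb p τ) (orb p σ, orb p τ) := by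
  rw [qMap_apply_sameSite γ Γ p hστ, qMap_apply_sameSite γ Γ p (Ne.symm hστ),
    two_apply_swap_sameSite hfst hsnd p σ τ]
  ring

omit [LinearOrder Λ] in
/-- `card (Orb Λ) = 2·|Λ|` (plumbing). [folklore] -/
theorem card_orb : Fintype.card (Orb Λ) = Fintype.card Λ * 2 := by
  simp [Fintype.card_prod]

/-- **THE HOP BOUND SUMMED OVER SPIN.** For a DQG-feasible pair with `N + 2 ≤ 2|Λ|` and sites
`p ≠ q`: `‖γ_{p↑,q↑}‖ + ‖γ_{p↓,q↓}‖ ≤ 2 (√(Re d_p) + √(Re e_p))` with `d_p = Γ_{(p↑,p↓),(p↑,p↓)}`,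
`e_p = ²Q_{(p↑,p↓),(p↑,p↓)}` — `Rows/StrongCouplingBookkeeping`'s `norm_one_hop_le_sqrt_add_sqrt`
for each spin, the `↓` weights rewritten as the `↑` ones. [folklore] -/
theorem sum_norm_hop_le (hf : IsDQGFeasible N γ Γ) (hr : N + 2 ≤ Fintype.card (Orb Λ)) {p q : Λ}
    (hpq : p ≠ q) :
    ∑ σ : Fin 2, ‖γ (orb p σ) (orb q σ)‖ ≤
      2 * (Real.sqrt (Γ (orb p 0, orb p 1) (orb p 0, orb p 1)).re +
        Real.sqrt (qMap γ Γ (orb p 0, orb p 1) (orb p 0, orb p 1)).re) := by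
  have h01 : (0 : Fin 2) ≠ 1 := by decide
  have h10 : (1 : Fin 2) ≠ 0 := by decide
  have hup := norm_one_hop_le_sqrt_add_sqrt hf hr h01 hpq
  have hdown := norm_one_hop_le_sqrt_add_sqrt hf hr h10 hpq
  rw [two_apply_swap_sameSite hf.swap_fst hf.swap_snd p 0 1,
    qMap_apply_swap_sameSite hf.swap_fst hf.swap_snd p h01] at hdown
  rw [Fin.sum_univ_two]
  linarith

end Pair

/-! ### §2 The energy of a Hubbard-type table on a feasible pair -/

section Energy

variable {γ : Matrix (Orb Λ) (Orb Λ) ℂ} {Γ : Matrix (Orb Λ × Orb Λ) (Orb Λ × Orb Λ) ℂ}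

/-- Collapse of an on-site four-index sum: `Σ_{q r s} [p = q = r = s]·f q r s = f p p p`.
(plumbing) [folklore] -/
theorem sum_ite_eq_eq_eq {β : Type*} [AddCommMonoid β] (p : Λ) (f : Λ → Λ → Λ → β) :
    (∑ q, ∑ r, ∑ s, if p = q ∧ q = r ∧ r = s then f q r s else 0) = f p p p := by
  classical
  have h1 : ∀ q r, (∑ s, if p = q ∧ q = r ∧ r = s then f q r s else 0)
      = if p = q ∧ q = r then f q r r else 0 := by
    intro q r
    by_cases hqr : p = q ∧ q = r
    · rw [if_pos hqr, Finset.sum_eq_single r]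
      · rw [if_pos ⟨hqr.1, hqr.2, rfl⟩]
      · intro s _ hs
        exact if_neg fun h => hs h.2.2.symm
      · intro h
        exact absurd (Finset.mem_univ r) h
    · rw [if_neg hqr]
      exact Finset.sum_eq_zero fun s _ => if_neg fun h => hqr ⟨h.1, h.2.1⟩
  have h2 : ∀ q, (∑ r, if p = q ∧ q = r then f q r r else 0) = if p = q then f q q q else 0 := by
    intro q
    by_cases hq : p = q
    · rw [if_pos hq, Finset.sum_eq_single q]
      · rw [if_pos ⟨hq, rfl⟩]
      · intro r _ hr
        exact if_neg fun h => hr h.2.symm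
      · intro h
        exact absurd (Finset.mem_univ q) h
    · rw [if_neg hq]
      exact Finset.sum_eq_zero fun r _ => if_neg fun h => hq h.1
  simp_rw [h1, h2]
  rw [Finset.sum_eq_single p, if_pos rfl]
  · intro q _ hq
    exact if_neg fun h => hq h.symm
  · intro h
    exact absurd (Finset.mem_univ p) h

/-- **THE INTERACTION TERM IS THE DOUBLON WEIGHT.** For an antisymmetric `Γ` and ON-SITE two-body
integrals `(pq|rs) = U·[p = q = r = s]`, the two-body part of the energy functional is
`½ Σ_{pqrs} (pq|rs) Σ_{στ} Γ_{(pσ,rτ),(qσ,sτ)} = U · Σ_p Γ_{(p↑,p↓),(p↑,p↓)}` (the `σ = τ` terms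
vanish, the `(↓↑)` term equals the `(↑↓)` term). [folklore] -/
theorem interaction_eq (hfst : ∀ i j q, Γ (j, i) q = -Γ (i, j) q)
    (hsnd : ∀ p k l, Γ p (l, k) = -Γ p (k, l)) (U : ℂ) {g : Λ → Λ → Λ → Λ → ℂ}
    (hg : ∀ p q r s, g p q r s = if p = q ∧ q = r ∧ r = s then U else 0) :
    (1 / 2 : ℂ) * ∑ p : Λ, ∑ q : Λ, ∑ r : Λ, ∑ s : Λ,
        g p q r s * ∑ σ : Fin 2, ∑ τ : Fin 2, Γ (orb p σ, orb r τ) (orb q σ, orb s τ)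
      = U * ∑ p : Λ, Γ (orb p 0, orb p 1) (orb p 0, orb p 1) := by
  have hin : ∀ p : Λ, (∑ q : Λ, ∑ r : Λ, ∑ s : Λ,
      g p q r s * ∑ σ : Fin 2, ∑ τ : Fin 2, Γ (orb p σ, orb r τ) (orb q σ, orb s τ))
      = U * (2 * Γ (orb p 0, orb p 1) (orb p 0, orb p 1)) := by
    intro p
    have hterm : ∀ q r s, g p q r s * ∑ σ : Fin 2, ∑ τ : Fin 2, Γ (orb p σ, orb r τ) (orb q σ, orb s τ)
        = if p = q ∧ q = r ∧ r = s then
            U * ∑ σ : Fin 2, ∑ τ : Fin 2, Γ (orb p σ, orb r τ) (orb q σ, orb s τ) else 0 := by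
      intro q r s
      rw [hg]
      split_ifs <;> simp
    rw [Finset.sum_congr rfl fun q _ => Finset.sum_congr rfl fun r _ =>
      Finset.sum_congr rfl fun s _ => hterm q r s,
      sum_ite_eq_eq_eq p (fun q r s => U * ∑ σ : Fin 2, ∑ τ : Fin 2,
        Γ (orb p σ, orb r τ) (orb q σ, orb s τ))]
    simp only [Fin.sum_univ_two]
    rw [two_apply_samePair_eq_zero hfst (orb p 0), two_apply_samePair_eq_zero hfst (orb p 1),
      two_apply_swap_sameSite hfst hsnd p 0 1]
    ring
  simp_rw [hin]
  rw [← Finset.mul_sum, ← Finset.mul_sum]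
  ring

omit [LinearOrder Λ] in
/-- **THE ONE-BODY TERM IS BOUNDED BY ITS MODULUS** (no feasibility needed):
`Re Σ_{pq} h_pq Σ_σ γ_{pσ,qσ} ≥ −Σ_{pq} ‖h_pq‖ Σ_σ ‖γ_{pσ,qσ}‖`. [folklore] -/
theorem re_oneBody_ge_neg (h : Λ → Λ → ℂ) (γ : Matrix (Orb Λ) (Orb Λ) ℂ) :
    -(∑ p : Λ, ∑ q : Λ, ‖h p q‖ * ∑ σ : Fin 2, ‖γ (orb p σ) (orb q σ)‖)
      ≤ (∑ p : Λ, ∑ q : Λ, h p q * ∑ σ : Fin 2, γ (orb p σ) (orb q σ)).re := by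
  rw [Complex.re_sum, ← Finset.sum_neg_distrib]
  refine Finset.sum_le_sum fun p _ => ?_
  rw [Complex.re_sum, ← Finset.sum_neg_distrib]
  refine Finset.sum_le_sum fun q _ => ?_
  have h1 : ‖h p q * ∑ σ : Fin 2, γ (orb p σ) (orb q σ)‖
      ≤ ‖h p q‖ * ∑ σ : Fin 2, ‖γ (orb p σ) (orb q σ)‖ := by
    rw [norm_mul]
    exact mul_le_mul_of_nonneg_left (norm_sum_le _ _) (norm_nonneg _)
  have h2 := (abs_le.1 (Complex.abs_re_le_norm (h p q * ∑ σ : Fin 2, γ (orb p σ) (orb q σ)))).1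
  linarith

variable {a b : ℕ}

/-- Per ordered pair of sites: `‖h_pq‖ · Σ_σ ‖γ_{pσ,qσ}‖ ≤ 2τ (√(Re d_p) + √(Re e_p))` for a
feasible pair of the half-filled sector programme (`|Λ| ≥ 2`), a table with `h_pp = 0` and
`‖h_pq‖ ≤ τ` (at `p = q` the left side vanishes). [folklore] -/
theorem norm_mul_sum_norm_hop_le (hf : IsDQGFeasibleSector a b γ Γ) (hN : a + b = Fintype.card Λ)
    (hΛ : 2 ≤ Fintype.card Λ) {h : Λ → Λ → ℂ} {τ : ℝ} (hτ : ∀ p q, ‖h p q‖ ≤ τ)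
    (hdiag : ∀ p, h p p = 0) (p q : Λ) :
    ‖h p q‖ * ∑ σ : Fin 2, ‖γ (orb p σ) (orb q σ)‖ ≤
      2 * τ * (Real.sqrt (Γ (orb p 0, orb p 1) (orb p 0, orb p 1)).re +
        Real.sqrt (qMap γ Γ (orb p 0, orb p 1) (orb p 0, orb p 1)).re) := by
  have hτ0 : 0 ≤ τ := le_trans (norm_nonneg _) (hτ p p)
  have hroots : 0 ≤ Real.sqrt (Γ (orb p 0, orb p 1) (orb p 0, orb p 1)).re +
      Real.sqrt (qMap γ Γ (orb p 0, orb p 1) (orb p 0, orb p 1)).re :=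
    add_nonneg (Real.sqrt_nonneg _) (Real.sqrt_nonneg _)
  by_cases hpq : p = q
  · subst hpq
    rw [hdiag, norm_zero, zero_mul]
    positivity
  · have hr : a + b + 2 ≤ Fintype.card (Orb Λ) := by rw [card_orb]; omega
    have hs := sum_norm_hop_le hf.dqg hr hpq
    calc ‖h p q‖ * ∑ σ : Fin 2, ‖γ (orb p σ) (orb q σ)‖
        ≤ τ * (2 * (Real.sqrt (Γ (orb p 0, orb p 1) (orb p 0, orb p 1)).re +
            Real.sqrt (qMap γ Γ (orb p 0, orb p 1) (orb p 0, orb p 1)).re)) :=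
          mul_le_mul (hτ p q) hs (sum_nonneg fun σ _ => norm_nonneg _) hτ0
      _ = _ := by ring

/-- **THE ONE-BODY TERM AT HALF FILLING.** For a feasible pair of the half-filled sector programme
(`a + b = |Λ| ≥ 2`) and a table with `h_pp = 0`, `‖h_pq‖ ≤ τ`:
`Re Σ_{pq} h_pq Σ_σ γ_{pσ,qσ} ≥ −4 τ |Λ| √|Λ| · √s`, `s = Σ_p Re d_p` — the hop bound per ordered
pair, Cauchy–Schwarz over sites, and `Σ_p Re e_p = s` (`sum_holon_eq_sum_doublon`). [folklore] -/
theorem re_oneBody_ge (hf : IsDQGFeasibleSector a b γ Γ) (hN : a + b = Fintype.card Λ)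
    (hΛ : 2 ≤ Fintype.card Λ) {h : Λ → Λ → ℂ} {τ : ℝ} (hτ : ∀ p q, ‖h p q‖ ≤ τ)
    (hdiag : ∀ p, h p p = 0) :
    -(4 * τ * Fintype.card Λ * Real.sqrt (Fintype.card Λ) *
        Real.sqrt (∑ p : Λ, (Γ (orb p 0, orb p 1) (orb p 0, orb p 1)).re))
      ≤ (∑ p : Λ, ∑ q : Λ, h p q * ∑ σ : Fin 2, γ (orb p σ) (orb q σ)).re := by
  have hτ0 : 0 ≤ τ := by
    obtain ⟨p⟩ : Nonempty Λ := Fintype.card_pos_iff.1 (by omega)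
    exact le_trans (norm_nonneg _) (hτ p p)
  -- nonnegativity of the weights
  have hd0 : ∀ p : Λ, 0 ≤ (Γ (orb p 0, orb p 1) (orb p 0, orb p 1)).re := fun p =>
    (Complex.nonneg_iff.1 (hf.dqg.d_psd.diag_nonneg (i := (orb p 0, orb p 1)))).1
  have he0 : ∀ p : Λ, 0 ≤ (qMap γ Γ (orb p 0, orb p 1) (orb p 0, orb p 1)).re := fun p =>
    (Complex.nonneg_iff.1 (hf.dqg.q_psd.diag_nonneg (i := (orb p 0, orb p 1)))).1
  -- half filling: total holon weight = total doublon weight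
  have hed : ∑ p : Λ, (qMap γ Γ (orb p 0, orb p 1) (orb p 0, orb p 1)).re
      = ∑ p : Λ, (Γ (orb p 0, orb p 1) (orb p 0, orb p 1)).re := by
    have hc := congrArg Complex.re (sum_holon_eq_sum_doublon γ Γ hf hN)
    rwa [Complex.re_sum, Complex.re_sum] at hc
  -- Cauchy–Schwarz over sites (the tree's lemma, Mauduit–Rivat prelims file)
  have hcsd := Literature.NumberTheory.LFunctions.MauduitRivat.sum_sqrt_le_sqrt_card_mul
    (Finset.univ : Finset Λ) (fun p _ => hd0 p)
  have hcse := Literature.NumberTheory.LFunctions.MauduitRivat.sum_sqrt_le_sqrt_card_mul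
    (Finset.univ : Finset Λ) (fun p _ => he0 p)
  rw [Finset.card_univ, hed] at hcse
  rw [Finset.card_univ] at hcsd
  rw [Real.sqrt_mul (Nat.cast_nonneg _)] at hcsd hcse
  -- the pairwise bound, summed
  have hsum : ∑ p : Λ, ∑ q : Λ, ‖h p q‖ * ∑ σ : Fin 2, ‖γ (orb p σ) (orb q σ)‖
      ≤ ∑ p : Λ, ∑ _q : Λ, 2 * τ * (Real.sqrt (Γ (orb p 0, orb p 1) (orb p 0, orb p 1)).re +
          Real.sqrt (qMap γ Γ (orb p 0, orb p 1) (orb p 0, orb p 1)).re) :=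
    Finset.sum_le_sum fun p _ => Finset.sum_le_sum fun q _ =>
      norm_mul_sum_norm_hop_le hf hN hΛ hτ hdiag p q
  simp only [Finset.sum_const, Finset.card_univ, nsmul_eq_mul] at hsum
  rw [← Finset.mul_sum, ← Finset.mul_sum, Finset.sum_add_distrib] at hsum
  have h0 := re_oneBody_ge_neg h γ
  -- assemble
  have hmain : ∑ p : Λ, ∑ q : Λ, ‖h p q‖ * ∑ σ : Fin 2, ‖γ (orb p σ) (orb q σ)‖
      ≤ 4 * τ * Fintype.card Λ * Real.sqrt (Fintype.card Λ) *
        Real.sqrt (∑ p : Λ, (Γ (orb p 0, orb p 1) (orb p 0, orb p 1)).re) := by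
    have hc0 : (0 : ℝ) ≤ Fintype.card Λ := Nat.cast_nonneg _
    have h2τ : 0 ≤ 2 * τ := by linarith
    calc _ ≤ (Fintype.card Λ : ℝ) * (2 * τ *
          (∑ p : Λ, Real.sqrt (Γ (orb p 0, orb p 1) (orb p 0, orb p 1)).re +
            ∑ p : Λ, Real.sqrt (qMap γ Γ (orb p 0, orb p 1) (orb p 0, orb p 1)).re)) := hsum
      _ ≤ (Fintype.card Λ : ℝ) * (2 * τ * (Real.sqrt (Fintype.card Λ) *
          Real.sqrt (∑ p : Λ, (Γ (orb p 0, orb p 1) (orb p 0, orb p 1)).re) +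
            Real.sqrt (Fintype.card Λ) *
          Real.sqrt (∑ p : Λ, (Γ (orb p 0, orb p 1) (orb p 0, orb p 1)).re))) := by
          gcongr
      _ = _ := by ring
  linarith

/-- **CLAIM N (1), THE ENERGY BOUND.** For every feasible pair of the `D, Q, G` programme with the
sector rows `(a, b)` at HALF FILLING `a + b = |Λ| ≥ 2`, and every Hubbard-type integral table —
`h_pp = 0`, `‖h_pq‖ ≤ τ`, `(pq|rs) = U·[p = q = r = s]` with `U ∈ ℝ`, scalar `E_core` —
`Re E(γ, Γ) ≥ Re E_core + U·s − 4τ|Λ|√|Λ|·√s`, `s = Σ_p Re Γ_{(p↑,p↓),(p↑,p↓)}` (the total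
doublon weight). [folklore] -/
theorem re_rdmEnergy_ge (hf : IsDQGFeasibleSector a b γ Γ) (hN : a + b = Fintype.card Λ)
    (hΛ : 2 ≤ Fintype.card Λ) {h : Λ → Λ → ℂ} {τ : ℝ} (hτ : ∀ p q, ‖h p q‖ ≤ τ)
    (hdiag : ∀ p, h p p = 0) (U : ℝ) {g : Λ → Λ → Λ → Λ → ℂ}
    (hg : ∀ p q r s, g p q r s = if p = q ∧ q = r ∧ r = s then (U : ℂ) else 0) (hnuc : ℂ) :
    hnuc.re + U * ∑ p : Λ, (Γ (orb p 0, orb p 1) (orb p 0, orb p 1)).re -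
        4 * τ * Fintype.card Λ * Real.sqrt (Fintype.card Λ) *
          Real.sqrt (∑ p : Λ, (Γ (orb p 0, orb p 1) (orb p 0, orb p 1)).re)
      ≤ (rdmEnergy h g hnuc γ Γ).re := by
  have hone := re_oneBody_ge hf hN hΛ hτ hdiag
  have htwo := interaction_eq hf.dqg.swap_fst hf.dqg.swap_snd (U : ℂ) hg
  have hre : (∑ p : Λ, Γ (orb p 0, orb p 1) (orb p 0, orb p 1)).re
      = ∑ p : Λ, (Γ (orb p 0, orb p 1) (orb p 0, orb p 1)).re := Complex.re_sum _ _
  rw [rdmEnergy, Complex.add_re, Complex.add_re, htwo, Complex.re_ofReal_mul, hre]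
  linarith

/-- **CLAIM N (1), THE DOUBLON WEIGHT IS `O(1/U²)`.** Under the same hypotheses with `U > 0`: if
the pair's energy does not exceed the scalar, `Re E(γ, Γ) ≤ Re E_core` (the words' `OPT ≤ E₀ ≤ 0`
on the TV-H files, `E_core = 0`), then `s ≤ (4τ|Λ|√|Λ| / U)²` — by the scalar step
`ClaimN.le_sq_div_of_mul_le_sqrt`. [folklore] -/
theorem sum_doublon_le_sq (hf : IsDQGFeasibleSector a b γ Γ) (hN : a + b = Fintype.card Λ)
    (hΛ : 2 ≤ Fintype.card Λ) {h : Λ → Λ → ℂ} {τ : ℝ} (hτ : ∀ p q, ‖h p q‖ ≤ τ)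
    (hdiag : ∀ p, h p p = 0) {U : ℝ} (hU : 0 < U) {g : Λ → Λ → Λ → Λ → ℂ}
    (hg : ∀ p q r s, g p q r s = if p = q ∧ q = r ∧ r = s then (U : ℂ) else 0) {hnuc : ℂ}
    (hE : (rdmEnergy h g hnuc γ Γ).re ≤ hnuc.re) :
    ∑ p : Λ, (Γ (orb p 0, orb p 1) (orb p 0, orb p 1)).re ≤
      (4 * τ * Fintype.card Λ * Real.sqrt (Fintype.card Λ) / U) ^ 2 := by
  have hs0 : 0 ≤ ∑ p : Λ, (Γ (orb p 0, orb p 1) (orb p 0, orb p 1)).re :=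
    sum_nonneg fun p _ =>
      (Complex.nonneg_iff.1 (hf.dqg.d_psd.diag_nonneg (i := (orb p 0, orb p 1)))).1
  have hb := re_rdmEnergy_ge hf hN hΛ hτ hdiag U hg hnuc
  exact ClaimN.le_sq_div_of_mul_le_sqrt hs0 hU (by linarith)

end Energy

end StrongCouplingDoublon

end Summit.Ventures.CertifiedQuantumChemistry
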